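import Summits.BirchSwinnertonDyer.BirchSwinnertonDyer.Theorems.KolyvaginRankRigidityAtTwoKolyvaginNonvanishingAtTwoFrameNonTorsionLevelOne
import HarnessLib

/-!
# Crux V1′θ `KolyvaginNonvanishingAtTwoFrameTheta` (stmt-BirchSwinnertonDyer-27219 ← V1′ 24622),
# line `level_one_split` (θ-form, pen g4 registration 09:29Z): REGISTERED STUB
# `stub_nonTorsionLevelOneTheta` — THE NON-TORSION LEVEL-ONE CASE WITH RELATIVE MARGIN
# (helper, PROVED, unconditional; width seat `bsd-line-krr2-p2` g6, row V1)

V1′θ asks, for every `θ, k`, for a non-zero Kolyvagin class `c_M(n) ≠ 0` with the RELATIVE margin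
`θ·M + k ≤ M(n)`. When some conductor-`1` datum has `P(1)` (= `y_K` up to the frame) of infinite order,
take `n = 1`: `M(1) = ∞` makes every margin free, and `c_M(1) ≠ 0` for a level `M ≥ 1` with
`2^M ∤ P(1)` in `E(K[1])` — exactly the landed margin-free proof (`KolyvaginAtTwo.stub_nonTorsionLevelOne`,
p607844: Mordell–Weil over `K[1]`, admissibility at `2` on the habitat, `Γ_K`-invariance of `P(1)`,
McCallum Cor. 4.5), re-run with the conductor pinned to `1`. HONEST FRAMING: the torsion case
`stub_torsionLevelOneTheta` (Kolyvagin's conjecture at `2`) is the research content and is NOT touched;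
V1′θ is not proved; BSD is not proved by any of this.

References: [GrossLMS1991] §2, §4 (4.1), Prop. 4.7 (1); [McCallumLMS1991] §4 Cor. 4.5, §5 Lemma 5.1;
[Kolyvagin1991MathAnn] p. 257 (relative margins).
-/

set_option autoImplicit false
-- the Theorems namespace of this sub repeats the summit name by design (D-0017 nested layout)
set_option linter.dupNamespace false

noncomputable section

open scoped Classical

open WeierstrassCurve Field Literature.NumberTheory.EllipticCurves
  Literature.NumberTheory.EllipticCurves.ModularForms

namespace Summit.BirchSwinnertonDyer.BirchSwinnertonDyer.Theorems.KolyvaginAtTwo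

/-- **REGISTERED STUB `stub_nonTorsionLevelOneTheta` of the 27219 skeleton (V1′θ, non-torsion case):**
if some conductor-`1` datum has `P(1)` of infinite order then for every `θ, k` there is a non-zero
class `c_M(1) ≠ 0`, `1 ≤ M`, with `θ M + k ≤ M(1) = ∞`. [cite: GrossLMS1991, §2, Prop. 4.7 (1)]
[cite: McCallumLMS1991, §4 Cor. 4.5, §5 Lemma 5.1] -/
theorem stub_nonTorsionLevelOneTheta : ∀ (W : WeierstrassCurve ℚ) [W.IsElliptic] [W.IsGloballyMinimal], ¬ W.HasCM → (Literature.NumberTheory.EllipticCurves.Rank1Residual.GoodOrd W 2 ∨ Literature.NumberTheory.EllipticCurves.Rank1Residual.Mult W 2) → (∀ m : ℕ, W.HasSurjectiveModNGaloisRep (2 ^ m : ℕ)) → ∀ (K : Type) [Field K] [NumberField K], Literature.NumberTheory.EllipticCurves.IsImaginaryQuadratic K → ∀ [NeZero (W.conductorNorm ℤ)], Literature.NumberTheory.EllipticCurves.SatisfiesHeegnerHypothesis (W.conductorNorm ℤ) K → Odd (NumberField.discr K) → NumberField.discr K ≠ -3 → AddSubgroup.torsionBy (W.baseChange K).toAffine.Point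 (2 : ℤ) = ⊥ → Literature.NumberTheory.EllipticCurves.SatisfiesHeegnerHypothesis 2 K → ∀ (Dt : Literature.NumberTheory.EllipticCurves.ModularForms.ModularParametrizationData W (W.conductorNorm ℤ)) (β : ℤ) (ι : K →+* ℂ), (4 * (W.conductorNorm ℤ : ℤ)) ∣ β ^ 2 - NumberField.discr K → (∃ d₁ : Literature.NumberTheory.EllipticCurves.KolyvaginHeegnerData Dt β ι 1, ¬ IsOfFinAddOrder d₁.derivedPoint) → ∀ θ k : ℕ, ∃ (n : ℕ) (d : Literature.NumberTheory.EllipticCurves.KolyvaginHeegnerData Dt β ι n) (M : ℕ), Literature.NumberTheory.EllipticCurves.KolyvaginDescent.KolSupp (Literature.NumberTheory.EllipticCurves.Zhang2014.IsKolyvaginPrime (W.conductorNorm ℤ) W K 2) n ∧ 1 ≤ M ∧ ((θ * M + k : ℕ) : ℕ∞) ≤ Literature.NumberTheory.EllipticCurves.Zhang2014.levelIndex W 2 n ∧ d.kolyvaginClass Nat.prime_two M ≠ 0 := by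
  intro W _ _ _ _ hsur K _ _ hK _ hHN hodd _ _ _ Dt β ι _ hex θ k
  obtain ⟨d₁, hnt⟩ := hex
  have hs : W.HasSurjectiveModNGaloisRep 2 := by simpa using hsur 1
  -- `E(K[1])` is finitely generated (Mordell–Weil over the number field `K[1]`)
  haveI := (finiteDimensional_and_isGalois_ringClassField hK ι one_ne_zero).1
  haveI : NumberField (ringClassField K ι 1) := NumberField.of_module_finite K _
  haveI : (W.baseChange (ringClassField K ι 1)).IsElliptic := by rw [baseChange]; infer_instance
  haveI : Module.Finite ℤ (W.baseChange (ringClassField K ι 1)).toAffine.Point := by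
    convert (W.baseChange (ringClassField K ι 1)).module_finite_point_holds
  -- a level `M ≥ 1` with `2^M ∤ P(1)`
  obtain ⟨M, hM1, hndiv⟩ := exists_not_two_pow_zsmul_eq
    (A := (W.baseChange (ringClassField K ι 1)).toAffine.Point) (y := d₁.derivedPoint) (by convert hnt)
  refine ⟨1, d₁, M, KolyvaginDescent.kolSupp_one _, hM1, by simp, ?_⟩
  refine (Summit.BirchSwinnertonDyer.Rank1Residual.X11b.Three.KolyCert.kolyvaginClass_ne_zero_iff
    d₁ Nat.prime_two M).mpr ⟨?_, ?_, ?_⟩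
  · exact isAdmissible_pointsSubgroup_two_of_heegner d₁ hs hK hodd hHN one_ne_zero M
  · exact toGeomPoints_derivedPoint_one_mem_invPoints hK hHN d₁ _
  · rintro ⟨Q, hQ⟩
    exact hndiv ⟨Q, by convert hQ⟩

end Summit.BirchSwinnertonDyer.BirchSwinnertonDyer.Theorems.KolyvaginAtTwo

end
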